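import Summits.BirchSwinnertonDyer.BirchSwinnertonDyer.Theorems.GenusKolyvaginAtTwoPowDvdShaCardAtTwoRTOrthogonalCapstone
import Summits.BirchSwinnertonDyer.BirchSwinnertonDyer.Theorems.GenusKolyvaginAtTwoPowDvdShaCardAtTwoRTTwinShaLaddersOfKolyvaginSupplies
import Summits.BirchSwinnertonDyer.BirchSwinnertonDyer.Theorems.GenusKolyvaginAtTwoPowDvdShaCardAtTwoRTRankZeroSide
import HarnessLib

/-!
# Route `GenusKolyvaginAtTwo`, LINE 18 (L_T `PowDvdShaCardAtTwoRT`, stmt-BirchSwinnertonDyer-23299, ex 23242) — THE K-SIDE CAPSTONE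
# OF ROAD (E4) ON L_T's OWN BINDERS: `2^{2M₀} ∣ #Ш(E_K)[2^∞]` from Kolyvagin's supplies IN THE REGISTERED KS SHAPE + Q2 + the
# published inputs + ONE displayed socket, X-ORTH (Cassels–Tate orthogonality of (+)- and (−)-Kolyvagin classes)

Seat `bsd-line-gk2-p2` g20 (PROVER seat 2/3, cell `bsd-f1-sign2`), `--supports stmt-BirchSwinnertonDyer-23299` (helper; closes
nothing). THEOREMS ONLY (no definition, no named fact, no `sorry`); BSD is not proved by any of this; neither is L_T.

WHAT. `pow_dvd_natCard_sha_of_kolyvaginSupplies_of_orthogonal` = the abstract capstone `pow_dvd_natCard_sha_of_depth_supplies_of_orthogonal`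
(`…RTOrthogonalCapstone`) with its frame DISCHARGED from L_T's binders: the habitat of `W` (non-CM, odd Tamagawa, `ρ_{E,2^n}` onto), `K`
(imaginary quadratic, `d_K` odd, `≠ −3`, Heegner), `(Dt, β, ι, d₁)`, `y_1` non-torsion, `¬ 2^{M₀+1} ∣ P(1)`, the non-trivial `τ`; NO `Δ < 0`,
NO twin `Wd`, NO genus budget, NO multiplicative place (those feed only KS's engine and X-ORTH's discharge).  Displayed: (P) `PubInputsAtTwo`
(only its Kolyvagin conjunct: `rank E(K) = 1`), (Q2) `KolyvaginRelationAtTwo` (Selmer property / own-prime vanishing of the supplied classes),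
the two KS supply clauses VERBATIM in the registered text's shape at a level `L ≥ M₀ + 1` — with the prime predicate
`ZK ℓ ∧ L ≤ idx ℓ ∧ X± ℓ` carrying an ARBITRARY extra per-prime condition `X₊`/`X₋` (intended: `FrobEqFrobInfty W K (2^L) ℓ`, which X-ORTH's
discharge needs on one parity — gk2-p4 memo §3(c)(i)) —, a bi-additive `B` on `Ш(E_K)[2^k]` (`M₀ ≤ k`) with the level-kernel clause, and
**X-ORTH in PROVENANCE CURRENCY**: `B(x, x′) = 0` whenever `x = ι(2^{L−e} c_L(n))`, `x′ = ι(2^{L−e′} c_L(n′))` for Kolyvagin data at square-free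
levels `n`, `n′` with primes `ZK ∧ L ≤ idx ∧ X₊` resp. `X₋`, `e, e′ ≤ k`, the two classes SELMER, vanishing at their OWN primes, of signs `w(E)` resp.
`−w(E)` (all four facts GIVEN to the discharger — gk2-p4's socket spec §4).  Conclusion: `2^{2M₀} ∣ #Ш(E_K)[2^∞]`, i.e. L_T's.
Frame discharge (this file): `E(K̄)` `2^L`-divisible (char 0); a generator `g` of `E(K)` modulo torsion (Tian–Yuan–Zhang `exists_generator_mod_torsion`,
rank `1` by Kolyvagin) is one modulo `2^L` (odd torsion); **its Kummer class has sign `−w(E)`**: Gross's Prop. 5.3 (`τ y_K + w y_K` torsion,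
tree `X11b.KolyvaginBottom.isOfFinAddOrder_map_sub_neg_rootNumber_smul`) transported from `y_K = k₀ g + t` (`k₀ ≠ 0`) to `g`, then
`conjAct_kummerMapTorsion` and odd torsion; `P₀ = y_K` with `2^L ∤ P₀` and `c_L(1) = δ(P₀)` (`…SuppliesFrame`); the supplied classes
`2^{L−Mr} c_L(n)` are Selmer (`zsmul_kolyvaginClass_two_mem_selmerGroup_of_forall`), vanish at own primes (`…_mem_torsionLocalKer_of_forall`),
have Gross's sign (`conjAct_zsmul_kolyvaginClass_two`) and McCallum's order (`addOrderOf_zsmul_kolyvaginClass_two`) — this is the provenance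
handed to X-ORTH.

References: [McCallumLMS1991] §4 Prop. 4.7, §5 Prop. 5.2, Thm. 5.4; [GrossLMS1991] §5 Prop. 5.3–5.4, Prop. 6.2; [Kolyvagin1991StructureSha];
[Kolyvagin1990] Thm. A; [SilvermanAEC2009] VIII.§2, X.4.2.
-/

set_option autoImplicit false
-- the Theorems namespace of this sub repeats the summit name by design (D-0017 nested layout)
set_option linter.dupNamespace false

noncomputable section

open scoped Classical
open scoped AddSubgroup

namespace Summit.BirchSwinnertonDyer.BirchSwinnertonDyer.Theorems.GenusExact.PlusDescent

open WeierstrassCurve NumberField IsDedekindDomain Field Literature.NumberTheory.EllipticCurves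
  Literature.NumberTheory.GaloisRepresentations Literature.NumberTheory.EllipticCurves.ModularForms AddSubgroup
open Summit.BirchSwinnertonDyer.BirchSwinnertonDyer.Theses.GenusKolyvaginAtTwo (KolyvaginRelationAtTwo)
open Summit.BirchSwinnertonDyer.Rank1Residual

/-! ## §1 The sign of the Mordell–Weil line -/

section Sign

variable (W : WeierstrassCurve ℚ) [W.IsElliptic] [W.IsGloballyMinimal] [NeZero (W.conductorNorm ℤ)]
  (K : Type) [Field K] [NumberField K]

/-- **The Kummer class of a generator of `E(K)` modulo torsion has sign `−w(E)`** (Gross Prop. 5.3 moved from `y_K` to the generator).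
`K` imaginary quadratic and Heegner for `N_W`, `τ ≠ 1`; `Ph ∈ E(K)` a Heegner point of infinite order; `g` with `E(K) = ℤg + torsion`;
`E(K)[2] = 0`.  Then `τ_* δ_{2^L}(g) = −w(E) • δ_{2^L}(g)`: `Ph ≡ k₀ g` modulo torsion with `k₀ ≠ 0`, `τ Ph + w Ph` is torsion (Gross), so
`k₀ (τ g + w g)` and then `τ g + w g` are torsion, of ODD order, hence `2^L`-divisible, hence killed by `δ`; and `τ_* δ g = δ(τ g)`.
[cite: GrossLMS1991, §5 Prop. 5.3] [cite: SilvermanAEC2009, VIII.§2] -/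
theorem conjAct_kummerMapTorsion_generator_eq (hK : IsImaginaryQuadratic K) (hH : SatisfiesHeegnerHypothesis (W.conductorNorm ℤ) K)
    (τ : K ≃ₐ[ℚ] K) (hτ : τ ≠ 1) {L : ℕ}
    (hdiv : ∀ P : geomPoints (W.baseChange K), ∃ Q : geomPoints (W.baseChange K), ((2 ^ L : ℕ) : ℤ) • Q = P)
    (h2 : ∀ P : (W.baseChange K).toAffine.Point, (2 : ℤ) • P = 0 → P = 0)
    {Ph : (W.baseChange K).toAffine.Point} (hPh : IsHeegnerPoint (W.conductorNorm ℤ) W K Ph) (hnt : ¬ IsOfFinAddOrder Ph)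
    (g : (W.baseChange K).toAffine.Point) (hgT : ∀ x : (W.baseChange K).toAffine.Point, ∃ c : ℤ, IsOfFinAddOrder (x - c • g)) :
    conjAct W τ ((2 ^ L : ℕ) : ℤ) (kummerMapTorsion (W.baseChange K) ((2 ^ L : ℕ) : ℤ) hdiv g) =
      (-W.rootNumber) • kummerMapTorsion (W.baseChange K) ((2 ^ L : ℕ) : ℤ) hdiv g := by
  -- Gross: `τ Ph + w Ph` is torsion
  have hgross := X11b.KolyvaginBottom.isOfFinAddOrder_map_sub_neg_rootNumber_smul (W := W) hK hH hPh τ hτ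
  -- `Ph = k₀ g + t₀`, `k₀ ≠ 0`
  obtain ⟨k₀, hk₀⟩ := hgT Ph
  have hk₀ne : k₀ ≠ 0 := by
    rintro rfl
    rw [zero_smul, sub_zero] at hk₀
    exact hnt hk₀
  -- the map `τ` on points is additive; torsion maps to torsion
  set τm := WeierstrassCurve.Affine.Point.map (W' := W) (τ : K →ₐ[ℚ] K) with hτm
  have hrew : τm Ph - (-W.rootNumber) • Ph = τm Ph + W.rootNumber • Ph := by rw [neg_smul, sub_neg_eq_add]
  rw [hrew] at hgross
  have ht₀ : IsOfFinAddOrder (τm (Ph - k₀ • g) + W.rootNumber • (Ph - k₀ • g)) :=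
    (τm.isOfFinAddOrder hk₀).add hk₀.zsmul
  -- `k₀ • (τ g + w g)` is torsion
  have hk : IsOfFinAddOrder (k₀ • (τm g + W.rootNumber • g)) := by
    have heq : k₀ • (τm g + W.rootNumber • g) =
        (τm Ph + W.rootNumber • Ph) + -(τm (Ph - k₀ • g) + W.rootNumber • (Ph - k₀ • g)) := by
      rw [map_sub, map_zsmul, zsmul_sub, smul_add, smul_comm W.rootNumber k₀ g]
      abel
    rw [heq]
    exact hgross.add ht₀.neg
  -- hence `τ g + w g` is torsion
  have ht : IsOfFinAddOrder (τm g + W.rootNumber • g) := by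
    obtain ⟨n, hn0, hn⟩ := (isOfFinAddOrder_iff_zsmul_eq_zero).mp hk
    rw [smul_smul] at hn
    exact (isOfFinAddOrder_iff_zsmul_eq_zero).mpr ⟨n * k₀, mul_ne_zero hn0 hk₀ne, hn⟩
  -- of odd order, so `2^L`-divisible, so killed by `δ`
  obtain ⟨Q, hQ⟩ := exists_zsmul_two_pow_eq_of_odd_addOrderOf (W.baseChange K) L (odd_addOrderOf_of_forall_two_smul_eq_zero _ h2 ht)
  have hδ : kummerMapTorsion (W.baseChange K) ((2 ^ L : ℕ) : ℤ) hdiv (τm g + W.rootNumber • g) = 0 := by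
    have hmem : τm g + W.rootNumber • g ∈ (kummerMapTorsion (W.baseChange K) ((2 ^ L : ℕ) : ℤ) hdiv).ker := by
      rw [kummerMapTorsion_ker]
      exact ⟨Q, hQ⟩
    exact (AddMonoidHom.mem_ker).mp hmem
  rw [map_add, map_zsmul, add_eq_zero_iff_eq_neg, ← neg_zsmul] at hδ
  rw [conjAct_kummerMapTorsion W τ _ hdiv g, ← hτm, hδ]

end Sign

/-! ## §2 The capstone on L_T's binders -/

/-- **L_T's CONCLUSION, K-SIDE, FROM THE REGISTERED KS SUPPLIES + X-ORTH (road (E4)), on L_T's own binders.**  See the module docstring.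
Inputs: (P) (its Kolyvagin conjunct), Q2, L_T's habitat for `W`, `K`, `(Dt, β, ι, d₁)`, `y_1` of infinite order, `¬ 2^{M₀+1} ∣ P(1)`, `τ ≠ 1`;
levels `L ≥ M₀ + 1`, `k ≥ M₀`; extra per-prime predicates `X₊`, `X₋`; a bi-additive `B` on `Ш(E_K)[2^k]` with the level-kernel clause; X-ORTH
in provenance currency; depth minima `Mr` and the two KS supply clauses (odd depths: sign `w(E)`, avoid `⟨u⟩`; even depths: sign `−w(E)`, avoid
`⟨u⟩ ⊔ ⟨c_L(1)⟩`).  Output: `2^{2M₀} ∣ #Ш(E_K)[2^∞]`. [cite: McCallumLMS1991, §4 Prop. 4.7, §5 Prop. 5.2, Thm. 5.4 (p. 310)]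
[cite: GrossLMS1991, §5 Prop. 5.3–5.4, Prop. 6.2] [cite: Kolyvagin1991StructureSha] [cite: Kolyvagin1990, Thm. A] -/
theorem pow_dvd_natCard_sha_of_kolyvaginSupplies_of_orthogonal (hP : PubInputsAtTwo) (hQ2 : KolyvaginRelationAtTwo)
    (W : WeierstrassCurve ℚ) [W.IsElliptic] [W.IsGloballyMinimal] [NeZero (W.conductorNorm ℤ)] (hcm : ¬ W.HasCM)
    (hT : Odd W.tamagawaProduct) (K : Type) [Field K] [NumberField K] (hIQ : IsImaginaryQuadratic K)
    (hodd : Odd (NumberField.discr K)) (h3 : NumberField.discr K ≠ -3) (hHe : SatisfiesHeegnerHypothesis (W.conductorNorm ℤ) K)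
    (hρ : ∀ n : ℕ, 0 < n → W.HasSurjectiveModNGaloisRep ((2 : ℤ) ^ n))
    (Dt : ModularParametrizationData W (W.conductorNorm ℤ)) (β : ℤ) (ι : K →+* ℂ) (d₁ : KolyvaginHeegnerData Dt β ι 1)
    (hy : ¬ IsOfFinAddOrder d₁.derivedPoint) (M₀ : ℕ)
    (hndiv : ¬ ∃ Q : (W.baseChange (ringClassField K ι 1)).toAffine.Point, ((2 ^ (M₀ + 1) : ℕ) : ℤ) • Q = d₁.derivedPoint)
    (τ : K ≃ₐ[ℚ] K) (hτ : τ ≠ 1) (L k : ℕ) (hML : M₀ + 1 ≤ L) (hkM : M₀ ≤ k) (Xp Xm : ℕ → Prop)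
    (B : ↥((↥(W.baseChange K).sha)[((2 ^ k : ℕ) : ℤ)]) →+ ↥((↥(W.baseChange K).sha)[((2 ^ k : ℕ) : ℤ)]) →+ AddCircle (1 : ℚ))
    (hker : ∀ x : ↥((↥(W.baseChange K).sha)[((2 ^ k : ℕ) : ℤ)]), B x = 0 →
      ∃ z : (W.baseChange K).sha, (2 ^ k) • z = (x : (W.baseChange K).sha))
    (hOrth : ∀ x x' : ↥((↥(W.baseChange K).sha)[((2 ^ k : ℕ) : ℤ)]),
      (∃ (n : ℕ) (d : KolyvaginHeegnerData Dt β ι n) (e : ℕ), Squarefree n ∧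
        (∀ ℓ ∈ n.primeFactors, Zhang2014.IsKolyvaginPrime (W.conductorNorm ℤ) W K 2 ℓ ∧ L ≤ Zhang2014.kolyvaginIndex W 2 ℓ ∧ Xp ℓ) ∧
        e ≤ k ∧
        ((2 ^ (L - e) : ℕ) : ℤ) • d.kolyvaginClass Nat.prime_two L ∈ selmerGroup (W.baseChange K) ((2 ^ L : ℕ) : ℤ) ∧
        (∀ ℓ ∈ n.primeFactors, ∀ v : HeightOneSpectrum (𝓞 K), ((ℓ : ℕ) : 𝓞 K) ∈ v.asIdeal →
          ((2 ^ (L - e) : ℕ) : ℤ) • d.kolyvaginClass Nat.prime_two L ∈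
            (W.baseChange K).torsionLocalKer (v.adicCompletion K) ((2 ^ L : ℕ) : ℤ)) ∧
        conjAct W τ ((2 ^ L : ℕ) : ℤ) (((2 ^ (L - e) : ℕ) : ℤ) • d.kolyvaginClass Nat.prime_two L) =
          W.rootNumber • (((2 ^ (L - e) : ℕ) : ℤ) • d.kolyvaginClass Nat.prime_two L) ∧
        ((x : (W.baseChange K).sha) : (W.baseChange K).galH1) =
          torsionH1ToH1 (W.baseChange K) ((2 ^ L : ℕ) : ℤ) (((2 ^ (L - e) : ℕ) : ℤ) • d.kolyvaginClass Nat.prime_two L)) →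
      (∃ (n : ℕ) (d : KolyvaginHeegnerData Dt β ι n) (e : ℕ), Squarefree n ∧
        (∀ ℓ ∈ n.primeFactors, Zhang2014.IsKolyvaginPrime (W.conductorNorm ℤ) W K 2 ℓ ∧ L ≤ Zhang2014.kolyvaginIndex W 2 ℓ ∧ Xm ℓ) ∧
        e ≤ k ∧
        ((2 ^ (L - e) : ℕ) : ℤ) • d.kolyvaginClass Nat.prime_two L ∈ selmerGroup (W.baseChange K) ((2 ^ L : ℕ) : ℤ) ∧
        (∀ ℓ ∈ n.primeFactors, ∀ v : HeightOneSpectrum (𝓞 K), ((ℓ : ℕ) : 𝓞 K) ∈ v.asIdeal →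
          ((2 ^ (L - e) : ℕ) : ℤ) • d.kolyvaginClass Nat.prime_two L ∈
            (W.baseChange K).torsionLocalKer (v.adicCompletion K) ((2 ^ L : ℕ) : ℤ)) ∧
        conjAct W τ ((2 ^ L : ℕ) : ℤ) (((2 ^ (L - e) : ℕ) : ℤ) • d.kolyvaginClass Nat.prime_two L) =
          (-W.rootNumber) • (((2 ^ (L - e) : ℕ) : ℤ) • d.kolyvaginClass Nat.prime_two L) ∧
        ((x' : (W.baseChange K).sha) : (W.baseChange K).galH1) =
          torsionH1ToH1 (W.baseChange K) ((2 ^ L : ℕ) : ℤ) (((2 ^ (L - e) : ℕ) : ℤ) • d.kolyvaginClass Nat.prime_two L)) →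
      B x x' = 0)
    (R : ℕ) (Mr : ℕ → ℕ) (hMr : ∀ j, Mr (j + 1) ≤ Mr j) (hMr0 : Mr 0 = M₀) (hMrR : Mr R = 0)
    (hOdd : ∀ m : ℕ, Mr (2 * m + 1) < Mr (2 * m) →
        ∀ (i : ℕ) (u : Fin i → galH1Torsion (W.baseChange K) ((2 ^ L : ℕ) : ℤ)), i ≤ 2 * m + 1 →
        (∀ j, u j ∈ selmerGroup (W.baseChange K) ((2 ^ L : ℕ) : ℤ) ∧
          conjAct W τ ((2 ^ L : ℕ) : ℤ) (u j) = W.rootNumber • u j) →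
        ∃ (n : ℕ) (_ : Squarefree n)
          (_ : ∀ ℓ ∈ n.primeFactors, Zhang2014.IsKolyvaginPrime (W.conductorNorm ℤ) W K 2 ℓ ∧ L ≤ Zhang2014.kolyvaginIndex W 2 ℓ ∧ Xp ℓ)
          (d : KolyvaginHeegnerData Dt β ι n),
          (∀ ℓ ∈ n.primeFactors, ∀ e : KolyvaginHeegnerData Dt β ι (n / ℓ),
            ((2 ^ (L - Mr (2 * m)) : ℕ) : ℤ) • e.kolyvaginClass Nat.prime_two L = 0) ∧
          addOrderOf (d.kolyvaginClass Nat.prime_two L) = 2 ^ (L - Mr (2 * m + 1)) ∧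
          -W.rootNumber * (-1) ^ n.primeFactors.card = W.rootNumber ∧
          Disjoint (zmultiples (((2 ^ (L - Mr (2 * m)) : ℕ) : ℤ) • d.kolyvaginClass Nat.prime_two L))
            (AddSubgroup.closure (Set.range u)))
    (hEven : ∀ m : ℕ, Mr (2 * m + 2) < Mr (2 * m + 1) →
        ∀ (i : ℕ) (u : Fin i → galH1Torsion (W.baseChange K) ((2 ^ L : ℕ) : ℤ)), i ≤ 2 * m + 1 →
        (∀ j, u j ∈ selmerGroup (W.baseChange K) ((2 ^ L : ℕ) : ℤ) ∧
          conjAct W τ ((2 ^ L : ℕ) : ℤ) (u j) = (-W.rootNumber) • u j) →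
        ∃ (n : ℕ) (_ : Squarefree n)
          (_ : ∀ ℓ ∈ n.primeFactors, Zhang2014.IsKolyvaginPrime (W.conductorNorm ℤ) W K 2 ℓ ∧ L ≤ Zhang2014.kolyvaginIndex W 2 ℓ ∧ Xm ℓ)
          (d : KolyvaginHeegnerData Dt β ι n),
          (∀ ℓ ∈ n.primeFactors, ∀ e : KolyvaginHeegnerData Dt β ι (n / ℓ),
            ((2 ^ (L - Mr (2 * m + 1)) : ℕ) : ℤ) • e.kolyvaginClass Nat.prime_two L = 0) ∧
          addOrderOf (d.kolyvaginClass Nat.prime_two L) = 2 ^ (L - Mr (2 * m + 2)) ∧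
          -W.rootNumber * (-1) ^ n.primeFactors.card = -W.rootNumber ∧
          Disjoint (zmultiples (((2 ^ (L - Mr (2 * m + 1)) : ℕ) : ℤ) • d.kolyvaginClass Nat.prime_two L))
            (AddSubgroup.closure (Set.range u) ⊔ zmultiples (d₁.kolyvaginClass Nat.prime_two L))) :
    2 ^ (2 * M₀) ∣ Nat.card (AddCommGroup.primaryComponent (W.baseChange K).sha 2) := by
  have h2 : Module.finrank ℚ K = 2 := hIQ.1
  have hne4 : NumberField.discr K ≠ -4 := fun h ↦ by
    rw [h] at hodd
    exact (Int.not_even_iff_odd.mpr hodd) ⟨-2, by norm_num⟩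
  have hL1 : 1 ≤ L := by omega
  have hn : ((2 ^ L : ℕ) : ℤ) ≠ 0 := by positivity
  -- surjectivity currencies
  have hsurN : ∀ m : ℕ, W.HasSurjectiveModNGaloisRep ((2 ^ m : ℕ) : ℤ) :=
    MinimalTwinBSDTwo.forall_hasSurjectiveModNGaloisRep_two_pow_of_pos W hρ
  have hsurN' : ∀ m : ℕ, W.HasSurjectiveModNGaloisRep (2 ^ m : ℕ) := fun m ↦ by exact_mod_cast hsurN m
  have hsurj1 : W.HasSurjectiveModNGaloisRep ((2 : ℤ) ^ 1) := hρ 1 one_pos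
  have hs2 : W.HasSurjectiveModNGaloisRep 2 := by simpa using hsurj1
  -- the Heegner point `Ph = y_K ↦ P(1)` and `rank E(K) = 1` (Kolyvagin)
  obtain ⟨Ph, hPh, hPhmap⟩ := AdditiveKoly.exists_isHeegnerPoint_map_eq_derivedPoint_one (W := W) (K := K) (Dt := Dt) (β := β)
    (ι := ι) hIQ hHe d₁
  have hnt : ¬ IsOfFinAddOrder Ph := fun h ↦ hy (by
    rw [← hPhmap]
    exact AddMonoidHom.isOfFinAddOrder _ h)
  have hrk1 : (W.baseChange K).mordellWeilRank = 1 := (hP.kolyvagin (W.conductorNorm ℤ) W K hIQ hHe hPh hnt).1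
  -- the frame at level `2^L`
  have hdiv : ∀ P : geomPoints (W.baseChange K), ∃ Q : geomPoints (W.baseChange K), ((2 ^ L : ℕ) : ℤ) • Q = P :=
    (W.baseChange K).zsmul_geomPoints_surjective_of_charZero hn
  have h2tors : ∀ P : (W.baseChange K).toAffine.Point, (2 : ℤ) • P = 0 → P = 0 := fun P hP ↦
    EigenClassesFinite.forall_zsmul_two_pow_baseChange_eq_zero_of_hasSurjectiveModNGaloisRep_two W K h2 hs2 1 P (by simpa using hP)
  haveI hell : (W.baseChange K).IsElliptic := inferInstanceAs ((W.map (algebraMap ℚ K)).IsElliptic)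
  obtain ⟨g, hgT⟩ := TianYuanZhang2017.W2.exists_generator_mod_torsion (W.baseChange K) hrk1.le
  have hg : ∀ P : (W.baseChange K).toAffine.Point, ∃ (c : ℤ) (Q : (W.baseChange K).toAffine.Point),
      ((2 ^ L : ℕ) : ℤ) • Q = P - c • g := fun P ↦ by
    obtain ⟨c, hc⟩ := hgT P
    obtain ⟨Q, hQ⟩ := exists_zsmul_two_pow_eq_of_odd_addOrderOf (W.baseChange K) L (odd_addOrderOf_of_forall_two_smul_eq_zero _ h2tors hc)
    exact ⟨c, Q, hQ⟩
  have hκ := conjAct_kummerMapTorsion_generator_eq W K hIQ hHe τ hτ hdiv h2tors hPh hnt g hgT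
  have hP₀ : ∀ Q : (W.baseChange K).toAffine.Point, ((2 ^ L : ℕ) : ℤ) • Q ≠ Ph :=
    forall_two_pow_smul_ne_bottom_of_not_dvd_derivedPoint d₁ Ph hPhmap hML hndiv
  have hc1 : d₁.kolyvaginClass Nat.prime_two L = kummerMapTorsion (W.baseChange K) ((2 ^ L : ℕ) : ℤ) hdiv Ph :=
    VisiblePairAtTwo.kolyvaginClass_one_two_eq_kummerMapTorsion W K hIQ hodd hHe hsurj1 L d₁ Ph hPhmap
  -- the minima in the large
  have hanti : ∀ a b, a ≤ b → Mr b ≤ Mr a := fun a b hab ↦ by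
    induction hab with
    | refl => exact le_rfl
    | step _ ih => exact (hMr _).trans ih
  have hMrM : ∀ j, Mr j ≤ M₀ := fun j ↦ (hanti 0 j (Nat.zero_le j)).trans hMr0.le
  have hMrL : ∀ j, Mr j ≤ L := fun j ↦ (hMrM j).trans (by omega)
  /- provenance currency: everything Q2 + Gross give about a supplied class `2^{L-M'} c_L(n)` -/
  have hprov : ∀ (X : ℕ → Prop) (s : ℤ) (M' k' : ℕ), k' ≤ M' → M' ≤ L → M' ≤ k → ∀ {n : ℕ} (hn' : Squarefree n)
      (hKolX : ∀ ℓ ∈ n.primeFactors, Zhang2014.IsKolyvaginPrime (W.conductorNorm ℤ) W K 2 ℓ ∧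
        L ≤ Zhang2014.kolyvaginIndex W 2 ℓ ∧ X ℓ)
      (d : KolyvaginHeegnerData Dt β ι n),
      (∀ ℓ ∈ n.primeFactors, ∀ e : KolyvaginHeegnerData Dt β ι (n / ℓ),
        ((2 ^ (L - M') : ℕ) : ℤ) • e.kolyvaginClass Nat.prime_two L = 0) →
      addOrderOf (d.kolyvaginClass Nat.prime_two L) = 2 ^ (L - k') →
      -W.rootNumber * (-1) ^ n.primeFactors.card = s →
      (((2 ^ (L - M') : ℕ) : ℤ) • d.kolyvaginClass Nat.prime_two L ∈ selmerGroup (W.baseChange K) ((2 ^ L : ℕ) : ℤ) ∧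
        conjAct W τ ((2 ^ L : ℕ) : ℤ) (((2 ^ (L - M') : ℕ) : ℤ) • d.kolyvaginClass Nat.prime_two L) =
          s • (((2 ^ (L - M') : ℕ) : ℤ) • d.kolyvaginClass Nat.prime_two L)) ∧
      (∃ (n₀ : ℕ) (d₀ : KolyvaginHeegnerData Dt β ι n₀) (e₀ : ℕ), Squarefree n₀ ∧
        (∀ ℓ ∈ n₀.primeFactors, Zhang2014.IsKolyvaginPrime (W.conductorNorm ℤ) W K 2 ℓ ∧ L ≤ Zhang2014.kolyvaginIndex W 2 ℓ ∧ X ℓ) ∧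
        e₀ ≤ k ∧
        ((2 ^ (L - e₀) : ℕ) : ℤ) • d₀.kolyvaginClass Nat.prime_two L ∈ selmerGroup (W.baseChange K) ((2 ^ L : ℕ) : ℤ) ∧
        (∀ ℓ ∈ n₀.primeFactors, ∀ v : HeightOneSpectrum (𝓞 K), ((ℓ : ℕ) : 𝓞 K) ∈ v.asIdeal →
          ((2 ^ (L - e₀) : ℕ) : ℤ) • d₀.kolyvaginClass Nat.prime_two L ∈
            (W.baseChange K).torsionLocalKer (v.adicCompletion K) ((2 ^ L : ℕ) : ℤ)) ∧
        conjAct W τ ((2 ^ L : ℕ) : ℤ) (((2 ^ (L - e₀) : ℕ) : ℤ) • d₀.kolyvaginClass Nat.prime_two L) =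
          s • (((2 ^ (L - e₀) : ℕ) : ℤ) • d₀.kolyvaginClass Nat.prime_two L) ∧
        ((2 ^ (L - M') : ℕ) : ℤ) • d.kolyvaginClass Nat.prime_two L = ((2 ^ (L - e₀) : ℕ) : ℤ) • d₀.kolyvaginClass Nat.prime_two L) ∧
      addOrderOf (((2 ^ (L - M') : ℕ) : ℤ) • d.kolyvaginClass Nat.prime_two L) = 2 ^ (M' - k') := by
    intro X s M' k' hkM' hML' hMk n hn' hKolX d hsub hordc hsign
    have hKol : ∀ ℓ ∈ n.primeFactors, Zhang2014.IsKolyvaginPrime (W.conductorNorm ℤ) W K 2 ℓ ∧ L ≤ Zhang2014.kolyvaginIndex W 2 ℓ :=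
      fun ℓ hℓ ↦ ⟨(hKolX ℓ hℓ).1, (hKolX ℓ hℓ).2.1⟩
    have hsel := zsmul_kolyvaginClass_two_mem_selmerGroup_of_forall W Dt β ι hQ2 hcm hIQ h3 hne4 hHe hT hsurN' hL1 (L - M') hn' hKol
      d hsub
    have hsg : conjAct W τ ((2 ^ L : ℕ) : ℤ) (((2 ^ (L - M') : ℕ) : ℤ) • d.kolyvaginClass Nat.prime_two L) =
        s • (((2 ^ (L - M') : ℕ) : ℤ) • d.kolyvaginClass Nat.prime_two L) := by
      rw [conjAct_zsmul_kolyvaginClass_two W Dt β ι hIQ h3 hne4 hodd hHe hsurj1 τ hτ hn' hL1 hKol d (L - M'), hsign]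
    have hvan : ∀ ℓ ∈ n.primeFactors, ∀ v : HeightOneSpectrum (𝓞 K), ((ℓ : ℕ) : 𝓞 K) ∈ v.asIdeal →
        ((2 ^ (L - M') : ℕ) : ℤ) • d.kolyvaginClass Nat.prime_two L ∈
          (W.baseChange K).torsionLocalKer (v.adicCompletion K) ((2 ^ L : ℕ) : ℤ) := fun ℓ hℓ v hv ↦
      zsmul_kolyvaginClass_two_mem_torsionLocalKer_of_forall W Dt β ι hQ2 hcm hIQ h3 hne4 hHe hsurN' hL1 (L - M') hn' hKol d hsub hℓ v hv
    exact ⟨⟨hsel, hsg⟩, ⟨n, d, M', hn', hKolX, hMk, hsel, hvan, hsg, rfl⟩,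
      addOrderOf_zsmul_kolyvaginClass_two W Dt β ι d hkM' hML' hordc⟩
  refine pow_dvd_natCard_sha_of_depth_supplies_of_orthogonal W K τ L k hdiv g hg W.rootNumber W.rootNumber_eq_one_or hκ Ph hP₀
    (fun y ↦ ∃ (n : ℕ) (d : KolyvaginHeegnerData Dt β ι n) (e : ℕ), Squarefree n ∧
        (∀ ℓ ∈ n.primeFactors, Zhang2014.IsKolyvaginPrime (W.conductorNorm ℤ) W K 2 ℓ ∧ L ≤ Zhang2014.kolyvaginIndex W 2 ℓ ∧ Xp ℓ) ∧
        e ≤ k ∧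
        ((2 ^ (L - e) : ℕ) : ℤ) • d.kolyvaginClass Nat.prime_two L ∈ selmerGroup (W.baseChange K) ((2 ^ L : ℕ) : ℤ) ∧
        (∀ ℓ ∈ n.primeFactors, ∀ v : HeightOneSpectrum (𝓞 K), ((ℓ : ℕ) : 𝓞 K) ∈ v.asIdeal →
          ((2 ^ (L - e) : ℕ) : ℤ) • d.kolyvaginClass Nat.prime_two L ∈
            (W.baseChange K).torsionLocalKer (v.adicCompletion K) ((2 ^ L : ℕ) : ℤ)) ∧
        conjAct W τ ((2 ^ L : ℕ) : ℤ) (((2 ^ (L - e) : ℕ) : ℤ) • d.kolyvaginClass Nat.prime_two L) =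
          W.rootNumber • (((2 ^ (L - e) : ℕ) : ℤ) • d.kolyvaginClass Nat.prime_two L) ∧
        y = ((2 ^ (L - e) : ℕ) : ℤ) • d.kolyvaginClass Nat.prime_two L)
    (fun y ↦ ∃ (n : ℕ) (d : KolyvaginHeegnerData Dt β ι n) (e : ℕ), Squarefree n ∧
        (∀ ℓ ∈ n.primeFactors, Zhang2014.IsKolyvaginPrime (W.conductorNorm ℤ) W K 2 ℓ ∧ L ≤ Zhang2014.kolyvaginIndex W 2 ℓ ∧ Xm ℓ) ∧
        e ≤ k ∧
        ((2 ^ (L - e) : ℕ) : ℤ) • d.kolyvaginClass Nat.prime_two L ∈ selmerGroup (W.baseChange K) ((2 ^ L : ℕ) : ℤ) ∧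
        (∀ ℓ ∈ n.primeFactors, ∀ v : HeightOneSpectrum (𝓞 K), ((ℓ : ℕ) : 𝓞 K) ∈ v.asIdeal →
          ((2 ^ (L - e) : ℕ) : ℤ) • d.kolyvaginClass Nat.prime_two L ∈
            (W.baseChange K).torsionLocalKer (v.adicCompletion K) ((2 ^ L : ℕ) : ℤ)) ∧
        conjAct W τ ((2 ^ L : ℕ) : ℤ) (((2 ^ (L - e) : ℕ) : ℤ) • d.kolyvaginClass Nat.prime_two L) =
          (-W.rootNumber) • (((2 ^ (L - e) : ℕ) : ℤ) • d.kolyvaginClass Nat.prime_two L) ∧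
        y = ((2 ^ (L - e) : ℕ) : ℤ) • d.kolyvaginClass Nat.prime_two L)
    B hker (fun x x' hx hx' ↦ ?_) M₀ R Mr hMr hMr0 hMrR hkM (fun m hlt i hi u hu hord ↦ ?_) (fun m hlt i hi u hu hord ↦ ?_)
  · -- X-ORTH in provenance currency
    obtain ⟨y, -, ⟨n, d, e, hn', hKol, he, hsel, hvan, hsg, rfl⟩, hx⟩ := hx
    obtain ⟨y', -, ⟨n', d', e', hn'', hKol', he', hsel', hvan', hsg', rfl⟩, hx'⟩ := hx'
    exact hOrth x x' ⟨n, d, e, hn', hKol, he, hsel, hvan, hsg, hx⟩ ⟨n', d', e', hn'', hKol', he', hsel', hvan', hsg', hx'⟩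
  · -- odd depth `2m+1`: sign `w(E)`, no seed
    obtain ⟨n, hn', hKolX, d, hsub, hordc, hsign, hdisj⟩ := hOdd m hlt i u (by omega) hu
    obtain ⟨hP, hprovy, hordy⟩ := hprov Xp W.rootNumber (Mr (2 * m)) (Mr (2 * m + 1)) (hMr _) (hMrL _) ((hMrM _).trans hkM)
      hn' hKolX d hsub hordc hsign
    exact ⟨_, hP, hprovy, hordy, hdisj⟩
  · -- even depth `2m+2`: sign `−w(E)`, seed `⟨c_L(1)⟩ = ⟨δ(Ph)⟩`
    obtain ⟨n, hn', hKolX, d, hsub, hordc, hsign, hdisj⟩ := hEven m hlt i u (by omega) hu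
    obtain ⟨hP, hprovy, hordy⟩ := hprov Xm (-W.rootNumber) (Mr (2 * m + 1)) (Mr (2 * m + 2)) (hMr _) (hMrL _)
      ((hMrM _).trans hkM) hn' hKolX d hsub hordc hsign
    exact ⟨_, hP, hprovy, hordy, by rwa [hc1] at hdisj⟩

end Summit.BirchSwinnertonDyer.BirchSwinnertonDyer.Theorems.GenusExact.PlusDescent

end
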